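import Summits.NavierStokesRegularity.NavierStokesRegularity.Theorems.FilamentSkeletonRssSkeletonJ1RLiaSelfWindow
import Summits.NavierStokesRegularity.NavierStokesRegularity.Theorems.FilamentSkeletonRssSkeletonJ1RSlipTools
import Summits.NavierStokesRegularity.NavierStokesRegularity.Theorems.FilamentSkeletonRssSkeletonJ1RMismatchTools

/-!
# Route `FilamentSkeletonRss` · crux `SkeletonJ1R` (stmt-NavierStokesRegularity-23610) · stub F2 `LiaDefectL` — SELF-STRAND BRICK (S3):
# the local-induction estimate with a LINEAR curvature envelope (the logarithmic window, cancellation-free = RATE B)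

Lead `ns-fsr-lead-23610` (g2), line `streamline_kantorovich_R` (skeleton of record v5).  Helper file `--supports stmt-NavierStokesRegularity-23610`;
route-independent (no `Theses` import).  Builds on bricks S1/S2 (`…SkeletonJ1RLiaSelfSplit`, `…SkeletonJ1RLiaSelfWindow`), the global chord–arc
lemma of `…SkeletonJ1RSlipTools` and the Cauchy majorant `∫ (a² + (σ−s)²)⁻¹ = π/a` of `…SkeletonJ1RMismatchTools`.

THE ESTIMATE (`selfStrand_sub_lia_le`).  Unit-speed `C²` curve with (envelope) `‖X″σ‖ ≤ ε₀ + ε₁|σ|` (the LIA reference's curvature grows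
linearly across the ball), (Lipschitz) `‖X″q − X″τ‖ ≤ H|q − τ|` for `|q − τ| ≤ R`, (oscillation) `‖X′u − X′v‖ ≤ θ ≤ 1`.  For `0 < R ≤ L`, `κ_R R ≤ 1`
(`κ_R ≥ ε₀ + ε₁(|τ|+R)`, `κ₀ ≥ ε₀ + ε₁|τ|`, `κ_L ≥ ε₀ + ε₁(|τ|+L)`) the self strand is integrable and
  `‖S(τ) − Λ_e(R) • X′τ × X″τ‖ ≤ 16R(H + κ_R²) + 8(κ_R R)²κ_R·Λ_e(R) + 16κ₀·log(L/R) + 16(ε₁ + κ_L²)(L − R) + 16π(θ + θ²)/L`.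
Zones: log window `|σ−τ| ≤ R` (brick S2's inner majorant, local chord constant `η = (κ_R R)²/2`), envelope zone `R < |σ−τ| ≤ L` (curvature bounds,
chord `≥ |σ−τ|/2`), far zone (oscillation bounds, Cauchy tail).  For the LIA reference (`R ≍ √Γ`, `L ≍ ℓ`) this is the cancellation-free RATE B of
the lead's F2-notes, `O((√Γ + |τ|)(log log Γ + Rb√log Γ)/log Γ)` after the `Γγ/4π` factor; the oddness refinements (RATE A) are not here.
HONEST FRAMING: MODEL rung, ∃-side helper lemmas (kernel calculus) toward stub F2 of a HYPOTHETICAL filament-type blow-up skeleton; F2 and the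
crux 23610 stay OPEN; nothing here bears on Navier–Stokes regularity, which is NOT proved. [folklore]
-/

-- `dupNamespace` off: the module name repeats `NavierStokesRegularity` by the tree's `Summits/<S>/<S>/Theorems` layout (same as every sibling file).
set_option linter.dupNamespace false

noncomputable section

namespace Summit.NavierStokesRegularity.NavierStokesRegularity.Theorems.SkeletonJ1RLiaSelf

open MeasureTheory Set intervalIntegral Filter
open Literature.Analysis.FluidPDE
open Summit.NavierStokesRegularity.NavierStokesRegularity.Theorems.SkeletonJ1RSlipTools (chord_arc_of_osc)
open Summit.NavierStokesRegularity.NavierStokesRegularity.Theorems.SkeletonJ1RMismatchTools (integral_inv_sq_add_sq integrable_inv_sq_add_sq)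
open scoped RealInnerProductSpace InnerProductSpace BigOperators Interval Topology

variable {X : ℝ → EuclideanSpace ℝ (Fin 3)}

/-! ## §1 Local chord–arc and envelope bookkeeping -/

/-- `|p − τ| ≤ |σ − τ|` and `|p| ≤ |τ| + |σ − τ|` for `p ∈ [[τ, σ]]`. [folklore] -/
theorem abs_le_of_mem_uIcc {τ σ p : ℝ} (hp : p ∈ uIcc τ σ) : |p - τ| ≤ |σ - τ| ∧ |p| ≤ |τ| + |σ - τ| := by
  have h1 : |p - τ| ≤ |σ - τ| := by
    rcases mem_uIcc.1 hp with ⟨ha, hb⟩ | ⟨ha, hb⟩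
    · rw [abs_of_nonneg (by linarith : (0:ℝ) ≤ p - τ), abs_of_nonneg (by linarith : (0:ℝ) ≤ σ - τ)]; linarith
    · rw [abs_of_nonpos (by linarith : p - τ ≤ 0), abs_of_nonpos (by linarith : σ - τ ≤ 0)]; linarith
  refine ⟨h1, ?_⟩
  calc |p| = |τ + (p - τ)| := by ring_nf
    _ ≤ |τ| + |p - τ| := abs_add_le _ _
    _ ≤ |τ| + |σ - τ| := by linarith

/-- Segment curvature bound from the linear envelope: on `[[τ, σ]]`, `‖X″‖ ≤ ε₀ + ε₁(|τ| + |σ − τ|)` (`ε₁ ≥ 0`). [folklore] -/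
theorem curvature_le_on_segment {ε₀ ε₁ : ℝ} (hε₁ : 0 ≤ ε₁) (henv : ∀ σ, ‖deriv (deriv X) σ‖ ≤ ε₀ + ε₁ * |σ|) (τ σ : ℝ) :
    ∀ p ∈ uIcc τ σ, ‖deriv (deriv X) p‖ ≤ ε₀ + ε₁ * (|τ| + |σ - τ|) := fun p hp =>
  (henv p).trans (by nlinarith [(abs_le_of_mem_uIcc hp).2])

/-- **Local chord–arc**: if `‖X′p − X′τ‖ ≤ ε` for all `p ∈ [[τ, σ]]` (unit-speed `C²` curve) then `(1 − ε²/2)|σ − τ| ≤ ‖X σ − X τ‖`. [folklore] -/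
theorem chord_ge_of_local_osc (hX : ContDiff ℝ 2 X) (hunit : ∀ s, ‖deriv X s‖ = 1) {τ σ ε : ℝ}
    (hosc : ∀ p ∈ uIcc τ σ, ‖deriv X p - deriv X τ‖ ≤ ε) : (1 - ε ^ 2 / 2) * |σ - τ| ≤ ‖X σ - X τ‖ := by
  -- adapted from `SkeletonJ1RSlipTools.inner_chord_deriv_ge_of_osc` / `chord_arc_of_osc` (global oscillation there, segment-local here)
  have hd : Differentiable ℝ X := hX.differentiable (by norm_num)
  have hc : Continuous (deriv X) := hX.continuous_deriv (by norm_num)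
  have hinner : ∀ p ∈ uIcc τ σ, 1 - ε ^ 2 / 2 ≤ ⟪deriv X τ, deriv X p⟫ := by
    intro p hp
    have h1 := hosc p hp
    have h2 : ‖deriv X p - deriv X τ‖ ^ 2 = 2 - 2 * ⟪deriv X τ, deriv X p⟫ := by
      rw [← real_inner_self_eq_norm_sq, inner_sub_left, inner_sub_right, inner_sub_right,
        real_inner_self_eq_norm_sq, real_inner_self_eq_norm_sq, hunit p, hunit τ, real_inner_comm (deriv X τ)]
      ring
    have h3 : ‖deriv X p - deriv X τ‖ ^ 2 ≤ ε ^ 2 := pow_le_pow_left₀ (norm_nonneg _) h1 2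
    linarith
  have hCS : ∀ v : EuclideanSpace ℝ (Fin 3), |⟪v, deriv X τ⟫| ≤ ‖v‖ := fun v => by
    simpa [hunit τ] using abs_real_inner_le_norm v (deriv X τ)
  rcases le_total τ σ with hτσ | hστ
  · have hftc : X σ - X τ = ∫ r in τ..σ, deriv X r :=
      (integral_deriv_eq_sub (fun x _ => hd x) (hc.intervalIntegrable _ _)).symm
    have hI : ⟪X σ - X τ, deriv X τ⟫ = ∫ r in τ..σ, ⟪deriv X τ, deriv X r⟫ := by
      rw [hftc, real_inner_comm, intervalIntegral.integral_of_le hτσ, intervalIntegral.integral_of_le hτσ,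
        ← integral_inner ((hc.integrableOn_Icc).mono_set Set.Ioc_subset_Icc_self)]
    have hmin : ∫ _ in τ..σ, (1 - ε ^ 2 / 2) ≤ ∫ r in τ..σ, ⟪deriv X τ, deriv X r⟫ := by
      refine intervalIntegral.integral_mono_on hτσ (continuous_const.intervalIntegrable _ _)
        ((continuous_const.inner hc).intervalIntegrable _ _) fun r hr => hinner r ?_
      rw [uIcc_of_le hτσ]; exact hr
    rw [intervalIntegral.integral_const, smul_eq_mul, ← hI] at hmin
    rw [abs_of_nonneg (sub_nonneg.2 hτσ)]
    have := (le_abs_self _).trans (hCS (X σ - X τ))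
    linarith
  · have hftc : X τ - X σ = ∫ r in σ..τ, deriv X r :=
      (integral_deriv_eq_sub (fun x _ => hd x) (hc.intervalIntegrable _ _)).symm
    have hI : ⟪X τ - X σ, deriv X τ⟫ = ∫ r in σ..τ, ⟪deriv X τ, deriv X r⟫ := by
      rw [hftc, real_inner_comm, intervalIntegral.integral_of_le hστ, intervalIntegral.integral_of_le hστ,
        ← integral_inner ((hc.integrableOn_Icc).mono_set Set.Ioc_subset_Icc_self)]
    have hmin : ∫ _ in σ..τ, (1 - ε ^ 2 / 2) ≤ ∫ r in σ..τ, ⟪deriv X τ, deriv X r⟫ := by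
      refine intervalIntegral.integral_mono_on hστ (continuous_const.intervalIntegrable _ _)
        ((continuous_const.inner hc).intervalIntegrable _ _) fun r hr => hinner r ?_
      rw [uIcc_comm, uIcc_of_le hστ]; exact hr
    rw [intervalIntegral.integral_const, smul_eq_mul, ← hI] at hmin
    rw [abs_of_nonpos (sub_nonpos.2 hστ), norm_sub_rev]
    have := (le_abs_self _).trans (hCS (X τ - X σ))
    linarith

/-! ## §2 The three zones -/

/-- **Zone 1 (logarithmic window `|σ − τ| ≤ R`).**  With the linear envelope, the local Lipschitz bound and `κ_R R ≤ 1`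
(`κ_R ≥ ε₀ + ε₁(|τ|+R)`): `‖F σ − G σ‖ ≤ 8H + 8κ_R² + 8(κ_R R)²κ_R · K_e(σ−τ)(σ−τ)²/2`. [folklore] -/
theorem majorant_zone_window (hX : ContDiff ℝ 2 X) (hunit : ∀ s, ‖deriv X s‖ = 1) {e : ℝ} (he : 0 < e)
    {τ σ R ε₀ ε₁ H κR : ℝ} (hε₁ : 0 ≤ ε₁) (henv : ∀ σ, ‖deriv (deriv X) σ‖ ≤ ε₀ + ε₁ * |σ|) (hH0 : 0 ≤ H)
    (hH : ∀ q, |q - τ| ≤ R → ‖deriv (deriv X) q - deriv (deriv X) τ‖ ≤ H * |q - τ|)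
    (hκR : ε₀ + ε₁ * (|τ| + R) ≤ κR) (hsmall : κR * R ≤ 1) (hσ : |σ - τ| ≤ R) :
    ‖((‖X τ - X σ‖ ^ 2 + e ^ 2) ^ (3 / 2 : ℝ))⁻¹ • cross (deriv X σ) (X τ - X σ) -
        (((((σ - τ) ^ 2 + e ^ 2) ^ (3 / 2 : ℝ))⁻¹ * ((σ - τ) ^ 2 / 2)) • cross (deriv X τ) (deriv (deriv X) τ))‖ ≤
      8 * H + 8 * κR ^ 2 + 8 * (κR * R) ^ 2 * κR * ((((σ - τ) ^ 2 + e ^ 2) ^ (3 / 2 : ℝ))⁻¹ * ((σ - τ) ^ 2 / 2)) := by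
  have hR0 : 0 ≤ R := (abs_nonneg _).trans hσ
  have hκR0 : 0 ≤ κR := by
    have h := henv τ
    have : ε₀ + ε₁ * |τ| ≤ κR := by nlinarith [mul_nonneg hε₁ hR0]
    exact (norm_nonneg _).trans (h.trans this)
  -- segment curvature ≤ κR
  have hκ : ∀ p ∈ uIcc τ σ, ‖deriv (deriv X) p‖ ≤ κR := fun p hp =>
    (curvature_le_on_segment hε₁ henv τ σ p hp).trans (by nlinarith [mul_le_mul_of_nonneg_left hσ hε₁])
  -- local Lipschitz on the segment
  have hHseg : ∀ q ∈ uIcc τ σ, ‖deriv (deriv X) q - deriv (deriv X) τ‖ ≤ H * |q - τ| := fun q hq =>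
    hH q ((abs_le_of_mem_uIcc hq).1.trans hσ)
  -- local oscillation ≤ κR·R, hence chord ≥ (1 − η)|σ − τ| with η = (κR R)²/2
  have hoscl : ∀ p ∈ uIcc τ σ, ‖deriv X p - deriv X τ‖ ≤ κR * R := by
    intro p hp
    have hsub : uIcc τ p ⊆ uIcc τ σ := uIcc_subset_uIcc left_mem_uIcc hp
    have h1 := norm_deriv_sub_deriv_le_on hX (τ := τ) (σ := p) (κ := κR) fun q hq => hκ q (hsub hq)
    exact h1.trans (mul_le_mul_of_nonneg_left (((abs_le_of_mem_uIcc hp).1).trans hσ) hκR0)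
  have hchord := chord_ge_of_local_osc hX hunit hoscl
  have hη0 : 0 ≤ (κR * R) ^ 2 / 2 := by positivity
  have hη1 : (κR * R) ^ 2 / 2 ≤ 1 / 2 := by
    have : (κR * R) ^ 2 ≤ 1 := by
      have h0 : 0 ≤ κR * R := mul_nonneg hκR0 hR0
      nlinarith
    linarith
  have h := norm_selfIntegrand_sub_windowModel_le hX hunit he hκ hH0 hHseg hη0 hη1 hchord (hκ τ left_mem_uIcc)
  calc _ ≤ 8 * H + 8 * κR ^ 2 + 16 * ((κR * R) ^ 2 / 2) * κR * ((((σ - τ) ^ 2 + e ^ 2) ^ (3 / 2 : ℝ))⁻¹ * ((σ - τ) ^ 2 / 2)) := h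
    _ = _ := by ring

/-- **Zone 2 (envelope zone `R < |σ − τ| ≤ L`).**  Linear envelope + global oscillation `θ ≤ 1` (chord `≥ |σ−τ|/2`):
`‖F σ‖ ≤ 8κ₀/|σ−τ| + 8ε₁ + 8κ_L²` (`κ₀ ≥ ε₀ + ε₁|τ|`, `κ_L ≥ ε₀ + ε₁(|τ|+L)`). [folklore] -/
theorem majorant_zone_envelope (hX : ContDiff ℝ 2 X) (hunit : ∀ s, ‖deriv X s‖ = 1) {e : ℝ} (he : 0 < e)
    {τ σ R L ε₀ ε₁ θ κ0 κL : ℝ} (hε₀ : 0 ≤ ε₀) (hε₁ : 0 ≤ ε₁) (henv : ∀ σ, ‖deriv (deriv X) σ‖ ≤ ε₀ + ε₁ * |σ|)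
    (hθ1 : θ ≤ 1) (hosc : ∀ u v, ‖deriv X u - deriv X v‖ ≤ θ)
    (hκ0 : ε₀ + ε₁ * |τ| ≤ κ0) (hκL : ε₀ + ε₁ * (|τ| + L) ≤ κL) (hR : 0 < R) (hσR : R < |σ - τ|) (hσL : |σ - τ| ≤ L) :
    ‖((‖X τ - X σ‖ ^ 2 + e ^ 2) ^ (3 / 2 : ℝ))⁻¹ • cross (deriv X σ) (X τ - X σ)‖ ≤ 8 * κ0 / |σ - τ| + 8 * ε₁ + 8 * κL ^ 2 := by
  set s := σ - τ with hs
  have hs0 : 0 < |s| := hR.trans hσR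
  have hστ : σ ≠ τ := sub_ne_zero.1 (abs_pos.1 hs0)
  set κs := ε₀ + ε₁ * (|τ| + |s|) with hκs
  have hκs0 : 0 ≤ κs := by positivity
  have hκ : ∀ p ∈ uIcc τ σ, ‖deriv (deriv X) p‖ ≤ κs := curvature_le_on_segment hε₁ henv τ σ
  -- chord ≥ |s|/2 from the global oscillation (θ ≤ 1)
  have hchord : (1 / 2 : ℝ) * |σ - τ| ≤ ‖X σ - X τ‖ := by
    have h := chord_arc_of_osc (hX.of_le (by norm_num)) hunit hosc σ τ
    have hθ0 : 0 ≤ θ := le_trans (norm_nonneg _) (hosc 0 0)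
    have : (1 / 2 : ℝ) * |σ - τ| ≤ (1 - θ ^ 2 / 2) * |σ - τ| :=
      mul_le_mul_of_nonneg_right (by nlinarith) (abs_nonneg _)
    exact this.trans h
  have hgA := norm_firstOrderTerm_le_of_curvature hX hκ
  have hgR := norm_secondOrderTerm_le_of_curvature hX hκ
  have hout := norm_selfIntegrand_le_outer e he hunit (by norm_num : (0:ℝ) < 1 / 2) hστ hchord hgA hgR
  -- (κs s² + κs²|s|³)/((1/2)³|s|³) = 8κs/|s| + 8κs²
  have hsq : (σ - τ) ^ 2 = |s| ^ 2 := by rw [hs, sq_abs]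
  have hs0' : |s| ≠ 0 := hs0.ne'
  have heval : (κs * (σ - τ) ^ 2 + κs ^ 2 * |σ - τ| ^ 3) / ((1 / 2 : ℝ) ^ 3 * |σ - τ| ^ 3) = 8 * κs / |s| + 8 * κs ^ 2 := by
    rw [hsq, ← hs]
    field_simp
    ring
  rw [heval] at hout
  -- κs/|s| ≤ κ0/|s| + ε₁ and κs ≤ κL
  have h1 : 8 * κs / |s| ≤ 8 * κ0 / |s| + 8 * ε₁ := by
    rw [hκs, show 8 * (ε₀ + ε₁ * (|τ| + |s|)) / |s| = 8 * (ε₀ + ε₁ * |τ|) / |s| + 8 * ε₁ by field_simp; ring]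
    gcongr
  have h2 : κs ≤ κL := by rw [hκs]; nlinarith [mul_le_mul_of_nonneg_left hσL hε₁]
  have h3 : 8 * κs ^ 2 ≤ 8 * κL ^ 2 := by
    nlinarith [mul_nonneg (sub_nonneg.2 h2) (add_nonneg (hκs0.trans h2) hκs0)]
  linarith

/-- **Zone 3 (far zone `|σ − τ| > L`).**  Global oscillation `θ ≤ 1`: `‖F σ‖ ≤ 16(θ + θ²)·(L² + (σ−τ)²)⁻¹` (`L > 0`). [folklore] -/
theorem majorant_zone_far (hX : ContDiff ℝ 2 X) (hunit : ∀ s, ‖deriv X s‖ = 1) {e : ℝ} (he : 0 < e) {τ σ L θ : ℝ}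
    (hθ1 : θ ≤ 1) (hosc : ∀ u v, ‖deriv X u - deriv X v‖ ≤ θ) (hL : 0 < L) (hσL : L < |σ - τ|) :
    ‖((‖X τ - X σ‖ ^ 2 + e ^ 2) ^ (3 / 2 : ℝ))⁻¹ • cross (deriv X σ) (X τ - X σ)‖ ≤
      16 * (θ + θ ^ 2) * (L ^ 2 + (σ - τ) ^ 2)⁻¹ := by
  set s := σ - τ with hs
  have hs0 : 0 < |s| := hL.trans hσL
  have hστ : σ ≠ τ := sub_ne_zero.1 (abs_pos.1 hs0)
  have hθ0 : 0 ≤ θ := le_trans (norm_nonneg _) (hosc 0 0)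
  have hchord : (1 / 2 : ℝ) * |σ - τ| ≤ ‖X σ - X τ‖ := by
    have h := chord_arc_of_osc (hX.of_le (by norm_num)) hunit hosc σ τ
    have : (1 / 2 : ℝ) * |σ - τ| ≤ (1 - θ ^ 2 / 2) * |σ - τ| :=
      mul_le_mul_of_nonneg_right (by nlinarith) (abs_nonneg _)
    exact this.trans h
  have hgA := norm_firstOrderTerm_le_of_osc hX (τ := τ) (σ := σ) (θ := θ) fun p _ => hosc σ p
  have hgR := norm_secondOrderTerm_le_of_osc hX (τ := τ) (σ := σ) (θ := θ) fun p _ => hosc p τ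
  have hout := norm_selfIntegrand_le_outer e he hunit (by norm_num : (0:ℝ) < 1 / 2) hστ hchord hgA hgR
  have hs0' : |s| ≠ 0 := hs0.ne'
  have heval : (θ * |σ - τ| + θ ^ 2 * |σ - τ|) / ((1 / 2 : ℝ) ^ 3 * |σ - τ| ^ 3) = 8 * (θ + θ ^ 2) / |s| ^ 2 := by
    rw [← hs]; field_simp; ring
  rw [heval] at hout
  refine hout.trans ?_
  -- 8(θ+θ²)/s² ≤ 16(θ+θ²)/(L² + s²) since L² ≤ s²
  have hs2 : L ^ 2 ≤ |s| ^ 2 := pow_le_pow_left₀ hL.le hσL.le 2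
  have hsq : (σ - τ) ^ 2 = |s| ^ 2 := by rw [hs, sq_abs]
  rw [hsq, div_eq_mul_inv]
  have hpos : 0 < |s| ^ 2 := by positivity
  have hpos2 : 0 < L ^ 2 + |s| ^ 2 := by positivity
  rw [show 8 * (θ + θ ^ 2) * (|s| ^ 2)⁻¹ = (θ + θ ^ 2) * (8 / |s| ^ 2) by ring,
    show 16 * (θ + θ ^ 2) * (L ^ 2 + |s| ^ 2)⁻¹ = (θ + θ ^ 2) * (16 / (L ^ 2 + |s| ^ 2)) by ring]
  refine mul_le_mul_of_nonneg_left ?_ (by positivity)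
  rw [div_le_div_iff₀ hpos hpos2]
  nlinarith

/-! ## §3 The estimate -/

/-- `∫_{τ+R}^{τ+L} (a·(σ−τ)⁻¹ + b) dσ = a·log(L/R) + b·(L − R)` (`0 < R ≤ L`). [folklore] -/
theorem integral_right_zone (a b τ : ℝ) {R L : ℝ} (hR : 0 < R) (hRL : R ≤ L) :
    ∫ σ in (τ + R)..(τ + L), (a * (σ - τ)⁻¹ + b) = a * Real.log (L / R) + b * (L - R) := by
  have hL : 0 < L := hR.trans_le hRL
  have h0 : (0:ℝ) ∉ uIcc R L := by
    rw [uIcc_of_le hRL]; exact fun h => (lt_irrefl (0:ℝ)) (hR.trans_le h.1)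
  have hc : ContinuousOn (fun σ : ℝ => (σ - τ)⁻¹) (uIcc (τ + R) (τ + L)) := by
    refine (continuousOn_id.sub continuousOn_const).inv₀ fun σ hσ => ?_
    rw [uIcc_of_le (by linarith : τ + R ≤ τ + L)] at hσ
    simp only [Pi.sub_apply, id_eq]
    exact ne_of_gt (by linarith [hσ.1])
  have I1 : IntervalIntegrable (fun σ : ℝ => a * (σ - τ)⁻¹) volume (τ + R) (τ + L) := (hc.intervalIntegrable).const_mul a
  have I2 : IntervalIntegrable (fun _ : ℝ => b) volume (τ + R) (τ + L) := continuous_const.intervalIntegrable _ _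
  rw [intervalIntegral.integral_add I1 I2, intervalIntegral.integral_const_mul, intervalIntegral.integral_const, smul_eq_mul,
    intervalIntegral.integral_comp_sub_right (fun s : ℝ => s⁻¹) τ]
  simp only [add_sub_cancel_left]
  rw [integral_inv h0]
  ring

/-- `∫_{τ−L}^{τ−R} (a·(τ−σ)⁻¹ + b) dσ = a·log(L/R) + b·(L − R)` (`0 < R ≤ L`). [folklore] -/
theorem integral_left_zone (a b τ : ℝ) {R L : ℝ} (hR : 0 < R) (hRL : R ≤ L) :
    ∫ σ in (τ - L)..(τ - R), (a * (τ - σ)⁻¹ + b) = a * Real.log (L / R) + b * (L - R) := by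
  have h0 : (0:ℝ) ∉ uIcc R L := by
    rw [uIcc_of_le hRL]; exact fun h => (lt_irrefl (0:ℝ)) (hR.trans_le h.1)
  have hc : ContinuousOn (fun σ : ℝ => (τ - σ)⁻¹) (uIcc (τ - L) (τ - R)) := by
    refine (continuousOn_const.sub continuousOn_id).inv₀ fun σ hσ => ?_
    rw [uIcc_of_le (by linarith : τ - L ≤ τ - R)] at hσ
    simp only [Pi.sub_apply, id_eq]
    exact ne_of_gt (by linarith [hσ.2])
  have I1 : IntervalIntegrable (fun σ : ℝ => a * (τ - σ)⁻¹) volume (τ - L) (τ - R) := (hc.intervalIntegrable).const_mul a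
  have I2 : IntervalIntegrable (fun _ : ℝ => b) volume (τ - L) (τ - R) := continuous_const.intervalIntegrable _ _
  rw [intervalIntegral.integral_add I1 I2, intervalIntegral.integral_const_mul, intervalIntegral.integral_const, smul_eq_mul,
    intervalIntegral.integral_comp_sub_left (fun s : ℝ => s⁻¹) τ]
  simp only [sub_sub_cancel]
  rw [integral_inv h0]
  ring

/-- **Self strand against the local-induction model — linear envelope, cancellation-free (RATE B brick).**  See the module docstring.
[folklore] -/
theorem selfStrand_sub_lia_le (hX : ContDiff ℝ 2 X) (hunit : ∀ s, ‖deriv X s‖ = 1) {e : ℝ} (he : 0 < e)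
    {τ R L ε₀ ε₁ H θ κR κ0 κL : ℝ} (hR : 0 < R) (hRL : R ≤ L) (hε₀ : 0 ≤ ε₀) (hε₁ : 0 ≤ ε₁)
    (henv : ∀ σ, ‖deriv (deriv X) σ‖ ≤ ε₀ + ε₁ * |σ|) (hH0 : 0 ≤ H)
    (hH : ∀ q, |q - τ| ≤ R → ‖deriv (deriv X) q - deriv (deriv X) τ‖ ≤ H * |q - τ|)
    (hθ1 : θ ≤ 1) (hosc : ∀ u v, ‖deriv X u - deriv X v‖ ≤ θ)
    (hκR : ε₀ + ε₁ * (|τ| + R) ≤ κR) (hκ0 : ε₀ + ε₁ * |τ| ≤ κ0) (hκL : ε₀ + ε₁ * (|τ| + L) ≤ κL) (hsmall : κR * R ≤ 1) :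
    Integrable (fun σ : ℝ => ((‖X τ - X σ‖ ^ 2 + e ^ 2) ^ (3 / 2 : ℝ))⁻¹ • cross (deriv X σ) (X τ - X σ)) ∧
      ‖(∫ σ, ((‖X τ - X σ‖ ^ 2 + e ^ 2) ^ (3 / 2 : ℝ))⁻¹ • cross (deriv X σ) (X τ - X σ)) -
          (Real.arsinh (R / e) - R / Real.sqrt (R ^ 2 + e ^ 2)) • cross (deriv X τ) (deriv (deriv X) τ)‖ ≤
        16 * R * (H + κR ^ 2) + 8 * (κR * R) ^ 2 * κR * (Real.arsinh (R / e) - R / Real.sqrt (R ^ 2 + e ^ 2)) +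
          16 * κ0 * Real.log (L / R) + 16 * (ε₁ + κL ^ 2) * (L - R) + 16 * Real.pi * (θ + θ ^ 2) / L := by
  have hL : 0 < L := hR.trans_le hRL
  have hθ0 : 0 ≤ θ := le_trans (norm_nonneg _) (hosc 0 0)
  have hκR0 : 0 ≤ κR := le_trans (by positivity) hκR
  have hκ00 : 0 ≤ κ0 := le_trans (by positivity) hκ0
  set Λ : ℝ := Real.arsinh (R / e) - R / Real.sqrt (R ^ 2 + e ^ 2) with hΛ
  set g : ℝ → ℝ := fun σ => (((σ - τ) ^ 2 + e ^ 2) ^ (3 / 2 : ℝ))⁻¹ * ((σ - τ) ^ 2 / 2) with hg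
  have hg0 : ∀ σ, 0 ≤ g σ := fun σ => mul_nonneg (kernel_pos e _ he).le (by positivity)
  have hgc : Continuous g := by
    refine Continuous.mul ?_ (((continuous_id.sub continuous_const).pow 2).div_const 2)
    exact ((((continuous_id.sub continuous_const).pow 2).add continuous_const).rpow_const
      fun _ => Or.inr (by norm_num)).inv₀
      fun σ => (Real.rpow_pos_of_pos (by positivity : (0:ℝ) < (σ - τ) ^ 2 + e ^ 2) _).ne'
  -- the four majorant pieces
  set c₁ : ℝ := 8 * H + 8 * κR ^ 2 with hc₁
  set c₂ : ℝ := 8 * (κR * R) ^ 2 * κR with hc₂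
  set c₃ : ℝ := 8 * ε₁ + 8 * κL ^ 2 with hc₃
  set c₄ : ℝ := 16 * (θ + θ ^ 2) with hc₄
  have hc₁0 : 0 ≤ c₁ := by positivity
  have hc₂0 : 0 ≤ c₂ := by positivity
  have hc₃0 : 0 ≤ c₃ := by positivity
  have hc₄0 : 0 ≤ c₄ := by positivity
  set m₁ : ℝ → ℝ := (Icc (τ - R) (τ + R)).indicator fun σ => c₁ + c₂ * g σ with hm₁
  set m₂ : ℝ → ℝ := (Icc (τ + R) (τ + L)).indicator fun σ => 8 * κ0 * (σ - τ)⁻¹ + c₃ with hm₂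
  set m₃ : ℝ → ℝ := (Icc (τ - L) (τ - R)).indicator fun σ => 8 * κ0 * (τ - σ)⁻¹ + c₃ with hm₃
  set m₄ : ℝ → ℝ := fun σ => c₄ * (L ^ 2 + (σ - τ) ^ 2)⁻¹ with hm₄
  have hm₁0 : ∀ σ, 0 ≤ m₁ σ := fun σ => by
    rw [hm₁]; exact Set.indicator_nonneg (fun x _ => by have := hg0 x; positivity) σ
  have hm₂0 : ∀ σ, 0 ≤ m₂ σ := fun σ => by
    rw [hm₂]; refine Set.indicator_nonneg (fun x hx => ?_) σ
    have : 0 < x - τ := by linarith [hx.1]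
    positivity
  have hm₃0 : ∀ σ, 0 ≤ m₃ σ := fun σ => by
    rw [hm₃]; refine Set.indicator_nonneg (fun x hx => ?_) σ
    have : 0 < τ - x := by linarith [hx.2]
    positivity
  have hm₄0 : ∀ σ, 0 ≤ m₄ σ := fun σ => by rw [hm₄]; positivity
  have hI₁ : Integrable m₁ :=
    ((continuous_const.add (continuous_const.mul hgc)).integrableOn_Icc).integrable_indicator measurableSet_Icc
  have hc2 : ContinuousOn (fun σ : ℝ => 8 * κ0 * (σ - τ)⁻¹ + c₃) (Icc (τ + R) (τ + L)) := by
    refine ((continuousOn_const.mul ((continuousOn_id.sub continuousOn_const).inv₀ fun σ hσ => ?_)).add continuousOn_const)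
    simp only [Pi.sub_apply, id_eq]
    exact ne_of_gt (by linarith [hσ.1])
  have hI₂ : Integrable m₂ := (hc2.integrableOn_Icc).integrable_indicator measurableSet_Icc
  have hc3 : ContinuousOn (fun σ : ℝ => 8 * κ0 * (τ - σ)⁻¹ + c₃) (Icc (τ - L) (τ - R)) := by
    refine ((continuousOn_const.mul ((continuousOn_const.sub continuousOn_id).inv₀ fun σ hσ => ?_)).add continuousOn_const)
    simp only [Pi.sub_apply, id_eq]
    exact ne_of_gt (by linarith [hσ.2])
  have hI₃ : Integrable m₃ := (hc3.integrableOn_Icc).integrable_indicator measurableSet_Icc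
  have hI₄ : Integrable m₄ := (integrable_inv_sq_add_sq hL τ).const_mul c₄
  have hv₁ : ∫ σ, m₁ σ = c₁ * (2 * R) + c₂ * Λ := by
    have I1 : IntervalIntegrable (fun _ : ℝ => c₁) volume (τ - R) (τ + R) := continuous_const.intervalIntegrable _ _
    have I2 : IntervalIntegrable (fun σ : ℝ => c₂ * g σ) volume (τ - R) (τ + R) := (continuous_const.mul hgc).intervalIntegrable _ _
    rw [hm₁, MeasureTheory.integral_indicator measurableSet_Icc, integral_Icc_eq_integral_Ioc,
      ← intervalIntegral.integral_of_le (by linarith : τ - R ≤ τ + R),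
      intervalIntegral.integral_add I1 I2,
      intervalIntegral.integral_const, smul_eq_mul, intervalIntegral.integral_const_mul]
    simp only [hg]
    rw [integral_window_model he τ hR.le, ← hΛ]
    ring
  have hv₂ : ∫ σ, m₂ σ = 8 * κ0 * Real.log (L / R) + c₃ * (L - R) := by
    rw [hm₂, MeasureTheory.integral_indicator measurableSet_Icc, integral_Icc_eq_integral_Ioc,
      ← intervalIntegral.integral_of_le (by linarith : τ + R ≤ τ + L), integral_right_zone _ _ τ hR hRL]
  have hv₃ : ∫ σ, m₃ σ = 8 * κ0 * Real.log (L / R) + c₃ * (L - R) := by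
    rw [hm₃, MeasureTheory.integral_indicator measurableSet_Icc, integral_Icc_eq_integral_Ioc,
      ← intervalIntegral.integral_of_le (by linarith : τ - L ≤ τ - R), integral_left_zone _ _ τ hR hRL]
  have hv₄ : ∫ σ, m₄ σ = c₄ * (Real.pi / L) := by
    rw [hm₄, MeasureTheory.integral_const_mul, integral_inv_sq_add_sq hL τ]
  set m : ℝ → ℝ := fun σ => m₁ σ + m₂ σ + m₃ σ + m₄ σ with hm
  have hmI : Integrable m := ((hI₁.add hI₂).add hI₃).add hI₄
  have hmaj : ∀ σ, ‖((‖X τ - X σ‖ ^ 2 + e ^ 2) ^ (3 / 2 : ℝ))⁻¹ • cross (deriv X σ) (X τ - X σ) -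
      (Icc (τ - R) (τ + R)).indicator
        (fun σ => ((((σ - τ) ^ 2 + e ^ 2) ^ (3 / 2 : ℝ))⁻¹ * ((σ - τ) ^ 2 / 2)) • cross (deriv X τ) (deriv (deriv X) τ)) σ‖ ≤
      m σ := by
    intro σ
    by_cases hin : |σ - τ| ≤ R
    · -- zone 1
      have hmem : σ ∈ Icc (τ - R) (τ + R) := by
        rw [abs_le] at hin; exact ⟨by linarith [hin.1], by linarith [hin.2]⟩
      rw [Set.indicator_of_mem hmem]
      have h1 := majorant_zone_window hX hunit he hε₁ henv hH0 hH hκR hsmall hin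
      have hm₁σ : m₁ σ = c₁ + c₂ * g σ := by rw [hm₁, Set.indicator_of_mem hmem]
      have : 8 * H + 8 * κR ^ 2 + 8 * (κR * R) ^ 2 * κR * g σ = m₁ σ := by rw [hm₁σ]
      calc _ ≤ 8 * H + 8 * κR ^ 2 + 8 * (κR * R) ^ 2 * κR * g σ := h1
        _ = m₁ σ := this
        _ ≤ m σ := by rw [hm]; linarith [hm₂0 σ, hm₃0 σ, hm₄0 σ]
    · push Not at hin
      have hnmem : σ ∉ Icc (τ - R) (τ + R) := by
        intro h
        have : |σ - τ| ≤ R := abs_le.2 ⟨by linarith [h.1], by linarith [h.2]⟩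
        linarith
      rw [Set.indicator_of_notMem hnmem, sub_zero]
      by_cases hmid : |σ - τ| ≤ L
      · -- zone 2
        have h2 := majorant_zone_envelope hX hunit he hε₀ hε₁ henv hθ1 hosc hκ0 hκL hR hin hmid
        rcases lt_or_gt_of_ne (show σ - τ ≠ 0 from fun h => by rw [h, abs_zero] at hin; linarith) with hneg | hpos
        · -- left piece
          have habs : |σ - τ| = τ - σ := by rw [abs_of_neg hneg]; ring
          have hmem : σ ∈ Icc (τ - L) (τ - R) := ⟨by rw [habs] at hmid; linarith, by rw [habs] at hin; linarith⟩
          have hm₃σ : m₃ σ = 8 * κ0 * (τ - σ)⁻¹ + c₃ := by rw [hm₃, Set.indicator_of_mem hmem]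
          calc _ ≤ 8 * κ0 / |σ - τ| + 8 * ε₁ + 8 * κL ^ 2 := h2
            _ = m₃ σ := by rw [hm₃σ, habs, hc₃, div_eq_mul_inv]; ring
            _ ≤ m σ := by rw [hm]; linarith [hm₁0 σ, hm₂0 σ, hm₄0 σ]
        · -- right piece
          have habs : |σ - τ| = σ - τ := abs_of_pos hpos
          have hmem : σ ∈ Icc (τ + R) (τ + L) := ⟨by rw [habs] at hin; linarith, by rw [habs] at hmid; linarith⟩
          have hm₂σ : m₂ σ = 8 * κ0 * (σ - τ)⁻¹ + c₃ := by rw [hm₂, Set.indicator_of_mem hmem]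
          calc _ ≤ 8 * κ0 / |σ - τ| + 8 * ε₁ + 8 * κL ^ 2 := h2
            _ = m₂ σ := by rw [hm₂σ, habs, hc₃, div_eq_mul_inv]; ring
            _ ≤ m σ := by rw [hm]; linarith [hm₁0 σ, hm₃0 σ, hm₄0 σ]
      · -- zone 3
        push Not at hmid
        have h3 := majorant_zone_far hX hunit he hθ1 hosc hL hmid
        calc _ ≤ c₄ * (L ^ 2 + (σ - τ) ^ 2)⁻¹ := h3
          _ = m₄ σ := by rw [hm₄]
          _ ≤ m σ := by rw [hm]; linarith [hm₁0 σ, hm₂0 σ, hm₃0 σ]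
  obtain ⟨hFint, hbound⟩ := selfStrand_sub_lia_le_of_majorant hX he τ hR.le hmI hmaj
  have hsum : ∫ σ, m σ = (c₁ * (2 * R) + c₂ * Λ) + (8 * κ0 * Real.log (L / R) + c₃ * (L - R)) +
      (8 * κ0 * Real.log (L / R) + c₃ * (L - R)) + c₄ * (Real.pi / L) := by
    have h12 : Integrable (fun σ => m₁ σ + m₂ σ) := hI₁.add hI₂
    have h123 : Integrable (fun σ => m₁ σ + m₂ σ + m₃ σ) := h12.add hI₃
    simp only [hm]
    rw [integral_add h123 hI₄, integral_add h12 hI₃, integral_add hI₁ hI₂, hv₁, hv₂, hv₃, hv₄]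
  refine ⟨hFint, hbound.trans (le_of_eq ?_)⟩
  rw [hsum, hc₁, hc₂, hc₃, hc₄]
  ring

end Summit.NavierStokesRegularity.NavierStokesRegularity.Theorems.SkeletonJ1RLiaSelf

end
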